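import Summits.Ventures.PercRepro.SixFourResidueFourPlaneLineTWDefs

/-!
# PercRepro — C-025 at `(6,4)`: the TW-100 table at `t = 4`, `33 ≤ g ≤ 52` (p3, gen 11 — §21.18.7)

The per-`g` checks `minCheckAll g` (the minimiser `m*(g,q)` of `L(g,q,m)/C(m,2)` is a minimiser, integer form) and
`twCheckAll g` (the cell inequality `w′(g,n,e,s) ≥ 0` of Lemma TW with `μ = L(m*)/C(m*,2)`, integer form) for `33 ≤ g ≤ 52`,
by `decide +kernel`; see `SixFourResidueFourPlaneLineTWDefs.lean` for the definitions and the transfer lemmas.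
-/

namespace PercRepro.SixFour

set_option maxRecDepth 20000

/-- `minCheckAll 33` (by `decide +kernel`). -/
theorem minCheckAll_33 : minCheckAll 33 := by unfold minCheckAll; decide +kernel
/-- `twCheckAll 33` (by `decide +kernel`). -/
theorem twCheckAll_33 : twCheckAll 33 := by unfold twCheckAll; decide +kernel

/-- `minCheckAll 34` (by `decide +kernel`). -/
theorem minCheckAll_34 : minCheckAll 34 := by unfold minCheckAll; decide +kernel
/-- `twCheckAll 34` (by `decide +kernel`). -/
theorem twCheckAll_34 : twCheckAll 34 := by unfold twCheckAll; decide +kernel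

/-- `minCheckAll 35` (by `decide +kernel`). -/
theorem minCheckAll_35 : minCheckAll 35 := by unfold minCheckAll; decide +kernel
/-- `twCheckAll 35` (by `decide +kernel`). -/
theorem twCheckAll_35 : twCheckAll 35 := by unfold twCheckAll; decide +kernel

/-- `minCheckAll 36` (by `decide +kernel`). -/
theorem minCheckAll_36 : minCheckAll 36 := by unfold minCheckAll; decide +kernel
/-- `twCheckAll 36` (by `decide +kernel`). -/
theorem twCheckAll_36 : twCheckAll 36 := by unfold twCheckAll; decide +kernel

/-- `minCheckAll 37` (by `decide +kernel`). -/
theorem minCheckAll_37 : minCheckAll 37 := by unfold minCheckAll; decide +kernel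
/-- `twCheckAll 37` (by `decide +kernel`). -/
theorem twCheckAll_37 : twCheckAll 37 := by unfold twCheckAll; decide +kernel

/-- `minCheckAll 38` (by `decide +kernel`). -/
theorem minCheckAll_38 : minCheckAll 38 := by unfold minCheckAll; decide +kernel
/-- `twCheckAll 38` (by `decide +kernel`). -/
theorem twCheckAll_38 : twCheckAll 38 := by unfold twCheckAll; decide +kernel

/-- `minCheckAll 39` (by `decide +kernel`). -/
theorem minCheckAll_39 : minCheckAll 39 := by unfold minCheckAll; decide +kernel
/-- `twCheckAll 39` (by `decide +kernel`). -/
theorem twCheckAll_39 : twCheckAll 39 := by unfold twCheckAll; decide +kernel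

/-- `minCheckAll 40` (by `decide +kernel`). -/
theorem minCheckAll_40 : minCheckAll 40 := by unfold minCheckAll; decide +kernel
/-- `twCheckAll 40` (by `decide +kernel`). -/
theorem twCheckAll_40 : twCheckAll 40 := by unfold twCheckAll; decide +kernel

/-- `minCheckAll 41` (by `decide +kernel`). -/
theorem minCheckAll_41 : minCheckAll 41 := by unfold minCheckAll; decide +kernel
/-- `twCheckAll 41` (by `decide +kernel`). -/
theorem twCheckAll_41 : twCheckAll 41 := by unfold twCheckAll; decide +kernel

/-- `minCheckAll 42` (by `decide +kernel`). -/
theorem minCheckAll_42 : minCheckAll 42 := by unfold minCheckAll; decide +kernel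
/-- `twCheckAll 42` (by `decide +kernel`). -/
theorem twCheckAll_42 : twCheckAll 42 := by unfold twCheckAll; decide +kernel

/-- `minCheckAll 43` (by `decide +kernel`). -/
theorem minCheckAll_43 : minCheckAll 43 := by unfold minCheckAll; decide +kernel
/-- `twCheckAll 43` (by `decide +kernel`). -/
theorem twCheckAll_43 : twCheckAll 43 := by unfold twCheckAll; decide +kernel

/-- `minCheckAll 44` (by `decide +kernel`). -/
theorem minCheckAll_44 : minCheckAll 44 := by unfold minCheckAll; decide +kernel
/-- `twCheckAll 44` (by `decide +kernel`). -/
theorem twCheckAll_44 : twCheckAll 44 := by unfold twCheckAll; decide +kernel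

/-- `minCheckAll 45` (by `decide +kernel`). -/
theorem minCheckAll_45 : minCheckAll 45 := by unfold minCheckAll; decide +kernel
/-- `twCheckAll 45` (by `decide +kernel`). -/
theorem twCheckAll_45 : twCheckAll 45 := by unfold twCheckAll; decide +kernel

/-- `minCheckAll 46` (by `decide +kernel`). -/
theorem minCheckAll_46 : minCheckAll 46 := by unfold minCheckAll; decide +kernel
/-- `twCheckAll 46` (by `decide +kernel`). -/
theorem twCheckAll_46 : twCheckAll 46 := by unfold twCheckAll; decide +kernel

/-- `minCheckAll 47` (by `decide +kernel`). -/
theorem minCheckAll_47 : minCheckAll 47 := by unfold minCheckAll; decide +kernel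
/-- `twCheckAll 47` (by `decide +kernel`). -/
theorem twCheckAll_47 : twCheckAll 47 := by unfold twCheckAll; decide +kernel

/-- `minCheckAll 48` (by `decide +kernel`). -/
theorem minCheckAll_48 : minCheckAll 48 := by unfold minCheckAll; decide +kernel
/-- `twCheckAll 48` (by `decide +kernel`). -/
theorem twCheckAll_48 : twCheckAll 48 := by unfold twCheckAll; decide +kernel

/-- `minCheckAll 49` (by `decide +kernel`). -/
theorem minCheckAll_49 : minCheckAll 49 := by unfold minCheckAll; decide +kernel
/-- `twCheckAll 49` (by `decide +kernel`). -/
theorem twCheckAll_49 : twCheckAll 49 := by unfold twCheckAll; decide +kernel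

/-- `minCheckAll 50` (by `decide +kernel`). -/
theorem minCheckAll_50 : minCheckAll 50 := by unfold minCheckAll; decide +kernel
/-- `twCheckAll 50` (by `decide +kernel`). -/
theorem twCheckAll_50 : twCheckAll 50 := by unfold twCheckAll; decide +kernel

/-- `minCheckAll 51` (by `decide +kernel`). -/
theorem minCheckAll_51 : minCheckAll 51 := by unfold minCheckAll; decide +kernel
/-- `twCheckAll 51` (by `decide +kernel`). -/
theorem twCheckAll_51 : twCheckAll 51 := by unfold twCheckAll; decide +kernel

/-- `minCheckAll 52` (by `decide +kernel`). -/
theorem minCheckAll_52 : minCheckAll 52 := by unfold minCheckAll; decide +kernel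
/-- `twCheckAll 52` (by `decide +kernel`). -/
theorem twCheckAll_52 : twCheckAll 52 := by unfold twCheckAll; decide +kernel

/-- `minCheckAll g` for every `33 ≤ g ≤ 52`. -/
theorem minCheckAll_of_rangeB {g : ℕ} (hg : 33 ≤ g) (hg' : g ≤ 52) : minCheckAll g := by
  interval_cases g
  exacts [minCheckAll_33, minCheckAll_34, minCheckAll_35, minCheckAll_36, minCheckAll_37, minCheckAll_38, minCheckAll_39, minCheckAll_40, minCheckAll_41, minCheckAll_42, minCheckAll_43, minCheckAll_44, minCheckAll_45, minCheckAll_46, minCheckAll_47, minCheckAll_48, minCheckAll_49, minCheckAll_50, minCheckAll_51, minCheckAll_52]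

/-- `twCheckAll g` for every `33 ≤ g ≤ 52`. -/
theorem twCheckAll_of_rangeB {g : ℕ} (hg : 33 ≤ g) (hg' : g ≤ 52) : twCheckAll g := by
  interval_cases g
  exacts [twCheckAll_33, twCheckAll_34, twCheckAll_35, twCheckAll_36, twCheckAll_37, twCheckAll_38, twCheckAll_39, twCheckAll_40, twCheckAll_41, twCheckAll_42, twCheckAll_43, twCheckAll_44, twCheckAll_45, twCheckAll_46, twCheckAll_47, twCheckAll_48, twCheckAll_49, twCheckAll_50, twCheckAll_51, twCheckAll_52]

end PercRepro.SixFour
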